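import Summits.CriticalPhenomena.Ising3D.TaylorRegionDeltaRows
import Mathlib.Tactic.Linarith
import Mathlib.Tactic.Positivity
import Mathlib.Tactic.Ring
import HarnessLib

/-!
# Piece checkers for δ-expanded row TRIPLES: `posCore3` / `posOn3` (one q-sum), `posCoreDE3` / `posOnDE3` (the 2×2
discriminant, product-free), `rowPos3`, and their soundness (item (L3a) of the box-width-robust region rows, part 2;
HOME/pub-ising3x-recog-1/gen12/REGION-ON-MARGIN-FUNCTIONAL.md §5)
(cell `pub-ising3x`, seat recog-1 gen 12; gate (g2))

HONEST FRAMING: lottery ticket; floor = tightest certified 3D Ising CFT bounds; no exact-solution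
claim without a proof. Island framing: certified exclusion region at stated derivative order and
assumptions; not a determination of the 3D Ising critical exponents beyond that.

Scaled piece bounds of an interval polynomial on `[lo, hi]` (Taylor shift to the midpoint, as the tree's `posCore`):
**`lowB`** (`lowB ≤ p(x)·S`, `lowB_le`) and **`absB`** (`|p(x)|·S ≤ absB`, `abs_le_absB`); for a triple `(R₀, R₁, R₂)` and
`|δ| ≤ W`: `lowB3 = lowB(R₀) − W·absB(R₁) − W²·absB(R₂)` and `absB3` (`lowB3_le`, `abs_le_absB3`); the checkers
**`posCore3` / `posOn3`** (`0 < lowB3`, bisection) with **`posOn3_sound`** (`r₀(x) + δ r₁(x) + δ² r₂(x) > 0` on the piece for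
all `|δ| ≤ W`), the product-free discriminant test **`posCoreDE3` / `posOnDE3`** (`X, Y > 0`, `absB3(Z)² < 4·lowB3(X)·lowB3(Y)`,
three independent `δ`'s — `Δσ`, `Δε`, their mean) with **`posOnDE3_sound`**, and the row test **`rowPos3`** with
**`qSum_pos_of_rowPos3`**: a q-sum is positive on `[max(E₀,j), E₁]` for EVERY `s` with `|s − s₀| ≤ W` when the test passes on
the rows of the δ-tables. MEASURED (Python twin gen12/measure/delta_rows.py on boot-1's margin functional, `Λ = 11`, 131 rows,
`S = 2^64`): the triple tests pass at box half-width 5e-5 … 2e-3 with ≈ 19 / 14 (X / Y, `posOn3`) and ≈ 91 (`posOnDE3`) leaves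
per row, where the landed single-interval rows fail from half-width 5e-5 on. Elementary. [folklore]
-/

namespace Summit.CriticalPhenomena.Ising3D

open Finset
open Literature.Analysis.ValidatedNumerics Literature.Analysis.ValidatedNumerics.PolyMP
open Literature.Analysis.ValidatedNumerics.NumericsMP (MI)
open Literature.MathematicalPhysics.QuantumFieldTheory.ConformalBootstrap3D

/-! ### (4) Piece bounds and the triple checker -/

/-- Scaled LOWER bound of an interval polynomial on `[lo, hi]`: Taylor shift to the midpoint, constant coefficient's lower
end minus the outward-rounded tail bound (the quantity `posCore` compares with zero). [folklore] -/
def lowB (S : ℕ) (P : IPoly) (lo hi : ℚ) : ℤ :=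
  let mid : ℚ := (lo + hi) / 2
  let hw : ℚ := (hi - lo) / 2
  match shiftI S P (MI.ofFrac S mid.num mid.den) with
  | [] => 0
  | s0 :: tail => s0.lo - Numerics.cdiv (hw.num * absBoundI S hw.num hw.den tail) hw.den

/-- Scaled upper bound of `|p|` on `[lo, hi]`. [folklore] -/
def absB (S : ℕ) (P : IPoly) (lo hi : ℚ) : ℤ :=
  let mid : ℚ := (lo + hi) / 2
  let hw : ℚ := (hi - lo) / 2
  absBoundI S hw.num hw.den (shiftI S P (MI.ofFrac S mid.num mid.den))

/-- **`|p(x)|·S ≤ absB`** on the piece. [folklore] -/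
theorem abs_le_absB {S : ℕ} (hS : 0 < S) {P : IPoly} {lo hi : ℚ} {as : List ℝ} (has : PMem S as P)
    {x : ℝ} (hlo : (lo : ℝ) ≤ x) (hhi : x ≤ hi) : |evalR as x| * S ≤ (absB S P lo hi : ℝ) := by
  set mid : ℚ := (lo + hi) / 2 with hmid
  set hw : ℚ := (hi - lo) / 2 with hhw
  have hleR : (lo : ℝ) ≤ hi := hlo.trans hhi
  have hmidR : ((mid : ℚ) : ℝ) = ((lo : ℝ) + hi) / 2 := by rw [hmid]; push_cast; ring
  have hhwR : ((hw : ℚ) : ℝ) = ((hi : ℝ) - lo) / 2 := by rw [hhw]; push_cast; ring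
  have hc : MI.mem S ((mid : ℚ) : ℝ) (MI.ofFrac S mid.num mid.den) := by
    rw [ratCast_eq_num_div_den]; exact MI.mem_ofFrac S mid.num mid.pos
  have hsh := pmem_shiftI hS hc has
  have hev : evalR as x = evalR (shiftR as ((mid : ℚ) : ℝ)) (x - mid) := by
    rw [evalR_shiftR]; congr 1; ring
  have hy : |x - mid| ≤ ((hw : ℚ) : ℝ) := by rw [hmidR, hhwR, abs_le]; constructor <;> linarith
  have hwnn : 0 ≤ hw := by
    have : (0 : ℝ) ≤ ((hw : ℚ) : ℝ) := by rw [hhwR]; linarith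
    exact_mod_cast this
  have hn0 : 0 ≤ hw.num := Rat.num_nonneg.mpr hwnn
  have h1 := abs_evalR_le_absBoundR (shiftR as ((mid : ℚ) : ℝ)) hy
  have h2 := absBoundR_le_absBoundI hn0 hw.pos hsh
  rw [← ratCast_eq_num_div_den] at h2
  have hS0 : (0 : ℝ) ≤ S := by positivity
  rw [hev]
  dsimp only [absB]
  rw [← hmid, ← hhw]
  exact (mul_le_mul_of_nonneg_right h1 hS0).trans h2

/-- **`lowB ≤ p(x)·S`** on the piece. [folklore] -/
theorem lowB_le {S : ℕ} (hS : 0 < S) {P : IPoly} {lo hi : ℚ} {as : List ℝ} (has : PMem S as P)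
    {x : ℝ} (hlo : (lo : ℝ) ≤ x) (hhi : x ≤ hi) : (lowB S P lo hi : ℝ) ≤ evalR as x * S := by
  set mid : ℚ := (lo + hi) / 2 with hmid
  set hw : ℚ := (hi - lo) / 2 with hhw
  have hmidR : ((mid : ℚ) : ℝ) = ((lo : ℝ) + hi) / 2 := by rw [hmid]; push_cast; ring
  have hhwR : ((hw : ℚ) : ℝ) = ((hi : ℝ) - lo) / 2 := by rw [hhw]; push_cast; ring
  have hc : MI.mem S ((mid : ℚ) : ℝ) (MI.ofFrac S mid.num mid.den) := by
    rw [ratCast_eq_num_div_den]; exact MI.mem_ofFrac S mid.num mid.pos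
  have hsh := pmem_shiftI hS hc has
  have hev : evalR as x = evalR (shiftR as ((mid : ℚ) : ℝ)) (x - mid) := by
    rw [evalR_shiftR]; congr 1; ring
  have hy : |x - mid| ≤ ((hw : ℚ) : ℝ) := by rw [hmidR, hhwR, abs_le]; constructor <;> linarith
  have hwnn : 0 ≤ hw := by
    have : (0 : ℝ) ≤ ((hw : ℚ) : ℝ) := by rw [hhwR]; linarith
    exact_mod_cast this
  have hn0 : 0 ≤ hw.num := Rat.num_nonneg.mpr hwnn
  have hS0 : (0 : ℝ) ≤ S := by positivity
  rw [hev]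
  dsimp only [lowB]
  rw [← hmid, ← hhw]
  generalize hsp : shiftI S P (MI.ofFrac S mid.num mid.den) = SP at hsh ⊢
  generalize hsr : shiftR as ((mid : ℚ) : ℝ) = SR at hsh ⊢
  match SP, SR, hsh with
  | [], [], _ => simp
  | s0 :: tail, a0 :: tR, List.Forall₂.cons ha0 htail =>
      rw [evalR_cons]
      have hB := absBoundR_le_absBoundI (S := S) hn0 hw.pos htail
      rw [← ratCast_eq_num_div_den] at hB
      have htl := abs_evalR_le_absBoundR tR hy
      have hdz : (0 : ℤ) < hw.den := by exact_mod_cast hw.pos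
      have hcd := Numerics.le_cdiv_mul_real (a := hw.num * absBoundI S hw.num hw.den tail) hdz
      have ha0m := ha0.1
      have hwR : ((hw : ℚ) : ℝ) = (hw.num : ℝ) / hw.den := ratCast_eq_num_div_den hw
      have hdR : (0 : ℝ) < hw.den := by exact_mod_cast hw.pos
      have key : ((hw : ℚ) : ℝ) * absBoundR tR ((hw : ℚ) : ℝ) * S ≤
          ((Numerics.cdiv (hw.num * absBoundI S hw.num hw.den tail) hw.den : ℤ) : ℝ) := by
        have h5 : ((hw.num * absBoundI S hw.num hw.den tail : ℤ) : ℝ) ≤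
            ((Numerics.cdiv (hw.num * absBoundI S hw.num hw.den tail) hw.den : ℤ) : ℝ) * hw.den := by
          exact_mod_cast hcd
        push_cast at h5
        have hnr : (0 : ℝ) ≤ hw.num := by exact_mod_cast hn0
        have h4 : (hw.num : ℝ) * (absBoundR tR ((hw : ℚ) : ℝ) * S) ≤ (hw.num : ℝ) * (absBoundI S hw.num hw.den tail : ℝ) :=
          mul_le_mul_of_nonneg_left hB hnr
        rw [hwR] at h4 ⊢
        rw [div_mul_eq_mul_div, div_mul_eq_mul_div, div_le_iff₀ hdR]
        nlinarith [h4, h5]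
      have hprod : |(x - mid) * evalR tR (x - mid)| ≤ ((hw : ℚ) : ℝ) * absBoundR tR ((hw : ℚ) : ℝ) := by
        rw [abs_mul]
        have hwnnR : (0 : ℝ) ≤ ((hw : ℚ) : ℝ) := by exact_mod_cast hwnn
        exact mul_le_mul hy htl (abs_nonneg _) hwnnR
      have habs := (abs_le.1 hprod).1
      have h5 : -(((hw : ℚ) : ℝ) * absBoundR tR ((hw : ℚ) : ℝ)) * S ≤ (x - mid) * evalR tR (x - mid) * S :=
        mul_le_mul_of_nonneg_right habs hS0
      push_cast
      nlinarith [ha0m, h5, key]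

/-- **Triple test on one piece**: `lowB(R₀) − W·absB(R₁) − W²·absB(R₂) > 0` (exact rational comparison). [folklore] -/
def posCore3 (S : ℕ) (R0 R1 R2 : IPoly) (lo hi W : ℚ) : Bool :=
  decide (W * (absB S R1 lo hi : ℚ) + W ^ 2 * (absB S R2 lo hi : ℚ) < (lowB S R0 lo hi : ℚ))

/-- Triple positivity checker with bisection to depth `d`. [folklore] -/
def posOn3 (S : ℕ) (R0 R1 R2 : IPoly) (W : ℚ) : ℕ → ℚ → ℚ → Bool
  | 0, a, b => posCore3 S R0 R1 R2 a b W
  | d + 1, a, b =>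
      posCore3 S R0 R1 R2 a b W || (posOn3 S R0 R1 R2 W d a ((a + b) / 2) && posOn3 S R0 R1 R2 W d ((a + b) / 2) b)

/-- **Soundness of the triple test.** [folklore] -/
theorem posCore3_sound {S : ℕ} (hS : 0 < S) {R0 R1 R2 : IPoly} {lo hi W : ℚ} (h : posCore3 S R0 R1 R2 lo hi W = true)
    (hW : 0 ≤ W) {r0 r1 r2 : List ℝ} (h0 : PMem S r0 R0) (h1 : PMem S r1 R1) (h2 : PMem S r2 R2)
    {x : ℝ} (hlo : (lo : ℝ) ≤ x) (hhi : x ≤ hi) {δ : ℝ} (hδ : |δ| ≤ W) :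
    0 < evalR r0 x + δ * evalR r1 x + δ ^ 2 * evalR r2 x := by
  have e0 := lowB_le hS h0 hlo hhi
  have e1 := abs_le_absB hS h1 hlo hhi
  have e2 := abs_le_absB hS h2 hlo hhi
  have hd := of_decide_eq_true h
  have hdR : (W : ℝ) * (absB S R1 lo hi : ℝ) + (W : ℝ) ^ 2 * (absB S R2 lo hi : ℝ) < (lowB S R0 lo hi : ℝ) := by
    exact_mod_cast hd
  have hSr : (0 : ℝ) < S := by exact_mod_cast hS
  have hS0 : (0 : ℝ) ≤ S := hSr.le
  have hWr : (0 : ℝ) ≤ W := by exact_mod_cast hW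
  have hδ0 : 0 ≤ |δ| := abs_nonneg δ
  have b1 : |δ * evalR r1 x| * S ≤ (W : ℝ) * absB S R1 lo hi := by
    rw [abs_mul, mul_assoc]
    exact mul_le_mul hδ e1 (by positivity) hWr
  have b2 : |δ ^ 2 * evalR r2 x| * S ≤ (W : ℝ) ^ 2 * absB S R2 lo hi := by
    rw [abs_mul, abs_pow, mul_assoc]
    exact mul_le_mul (pow_le_pow_left₀ hδ0 hδ 2) e2 (by positivity) (by positivity)
  have c1 : -((W : ℝ) * absB S R1 lo hi) ≤ δ * evalR r1 x * S := by
    have := mul_le_mul_of_nonneg_right (neg_abs_le (δ * evalR r1 x)) hS0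
    linarith
  have c2 : -((W : ℝ) ^ 2 * absB S R2 lo hi) ≤ δ ^ 2 * evalR r2 x * S := by
    have := mul_le_mul_of_nonneg_right (neg_abs_le (δ ^ 2 * evalR r2 x)) hS0
    linarith
  have hsum : 0 < (evalR r0 x + δ * evalR r1 x + δ ^ 2 * evalR r2 x) * S := by nlinarith
  nlinarith [hsum, hSr]

/-- **Soundness of the triple checker.** [folklore] -/
theorem posOn3_sound {S : ℕ} (hS : 0 < S) {R0 R1 R2 : IPoly} {W : ℚ} (hW : 0 ≤ W) {r0 r1 r2 : List ℝ}
    (h0 : PMem S r0 R0) (h1 : PMem S r1 R1) (h2 : PMem S r2 R2) : ∀ {d : ℕ} {lo hi : ℚ},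
    posOn3 S R0 R1 R2 W d lo hi = true → ∀ {x : ℝ}, (lo : ℝ) ≤ x → x ≤ hi → ∀ {δ : ℝ}, |δ| ≤ W →
      0 < evalR r0 x + δ * evalR r1 x + δ ^ 2 * evalR r2 x
  | 0, _, _, h, _, hlo, hhi, _, hδ => posCore3_sound hS h hW h0 h1 h2 hlo hhi hδ
  | d + 1, a, b, h, x, hlo, hhi, δ, hδ => by
      simp only [posOn3, Bool.or_eq_true, Bool.and_eq_true] at h
      rcases h with h | ⟨ha, hb⟩
      · exact posCore3_sound hS h hW h0 h1 h2 hlo hhi hδ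
      · have hmR : (((a + b) / 2 : ℚ) : ℝ) = ((a : ℝ) + b) / 2 := by push_cast; ring
        rcases le_or_gt x (((a : ℝ) + b) / 2) with hx | hx
        · exact posOn3_sound hS hW h0 h1 h2 ha hlo (by rw [hmR]; exact hx) hδ
        · exact posOn3_sound hS hW h0 h1 h2 hb (by rw [hmR]; exact hx.le) hhi hδ

/-! ### (4b) Triples: enclosure of `r₀ + δ r₁ + δ² r₂` on a piece and the product-free discriminant test -/

/-- A row triple `(R₀, R₁, R₂)`. [folklore] -/
abbrev ITriple := IPoly × IPoly × IPoly

/-- Scaled lower bound of `r₀(x) + δ r₁(x) + δ² r₂(x)` on the piece, `|δ| ≤ W`. [folklore] -/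
def lowB3 (S : ℕ) (T : ITriple) (lo hi W : ℚ) : ℚ :=
  (lowB S T.1 lo hi : ℚ) - W * (absB S T.2.1 lo hi : ℚ) - W ^ 2 * (absB S T.2.2 lo hi : ℚ)

/-- Scaled upper bound of `|r₀(x) + δ r₁(x) + δ² r₂(x)|` on the piece, `|δ| ≤ W`. [folklore] -/
def absB3 (S : ℕ) (T : ITriple) (lo hi W : ℚ) : ℚ :=
  (absB S T.1 lo hi : ℚ) + W * (absB S T.2.1 lo hi : ℚ) + W ^ 2 * (absB S T.2.2 lo hi : ℚ)

/-- [folklore] -/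
theorem lowB3_le {S : ℕ} (hS : 0 < S) {T : ITriple} {lo hi W : ℚ} (hW : 0 ≤ W) {r0 r1 r2 : List ℝ}
    (h0 : PMem S r0 T.1) (h1 : PMem S r1 T.2.1) (h2 : PMem S r2 T.2.2) {x : ℝ} (hlo : (lo : ℝ) ≤ x) (hhi : x ≤ hi)
    {δ : ℝ} (hδ : |δ| ≤ W) :
    ((lowB3 S T lo hi W : ℚ) : ℝ) ≤ (evalR r0 x + δ * evalR r1 x + δ ^ 2 * evalR r2 x) * S := by
  have e0 := lowB_le hS h0 hlo hhi
  have e1 := abs_le_absB hS h1 hlo hhi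
  have e2 := abs_le_absB hS h2 hlo hhi
  have hS0 : (0 : ℝ) ≤ S := by positivity
  have hWr : (0 : ℝ) ≤ W := by exact_mod_cast hW
  have hδ0 : 0 ≤ |δ| := abs_nonneg δ
  have b1 : |δ * evalR r1 x| * S ≤ (W : ℝ) * absB S T.2.1 lo hi := by
    rw [abs_mul, mul_assoc]; exact mul_le_mul hδ e1 (by positivity) hWr
  have b2 : |δ ^ 2 * evalR r2 x| * S ≤ (W : ℝ) ^ 2 * absB S T.2.2 lo hi := by
    rw [abs_mul, abs_pow, mul_assoc]
    exact mul_le_mul (pow_le_pow_left₀ hδ0 hδ 2) e2 (by positivity) (by positivity)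
  have c1 := mul_le_mul_of_nonneg_right (neg_abs_le (δ * evalR r1 x)) hS0
  have c2 := mul_le_mul_of_nonneg_right (neg_abs_le (δ ^ 2 * evalR r2 x)) hS0
  rw [lowB3]; push_cast; nlinarith

/-- [folklore] -/
theorem abs_le_absB3 {S : ℕ} (hS : 0 < S) {T : ITriple} {lo hi W : ℚ} (hW : 0 ≤ W) {r0 r1 r2 : List ℝ}
    (h0 : PMem S r0 T.1) (h1 : PMem S r1 T.2.1) (h2 : PMem S r2 T.2.2) {x : ℝ} (hlo : (lo : ℝ) ≤ x) (hhi : x ≤ hi)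
    {δ : ℝ} (hδ : |δ| ≤ W) :
    |evalR r0 x + δ * evalR r1 x + δ ^ 2 * evalR r2 x| * S ≤ ((absB3 S T lo hi W : ℚ) : ℝ) := by
  have e0 := abs_le_absB hS h0 hlo hhi
  have e1 := abs_le_absB hS h1 hlo hhi
  have e2 := abs_le_absB hS h2 hlo hhi
  have hS0 : (0 : ℝ) ≤ S := by positivity
  have hWr : (0 : ℝ) ≤ W := by exact_mod_cast hW
  have hδ0 : 0 ≤ |δ| := abs_nonneg δ
  have b1 : |δ * evalR r1 x| * S ≤ (W : ℝ) * absB S T.2.1 lo hi := by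
    rw [abs_mul, mul_assoc]; exact mul_le_mul hδ e1 (by positivity) hWr
  have b2 : |δ ^ 2 * evalR r2 x| * S ≤ (W : ℝ) ^ 2 * absB S T.2.2 lo hi := by
    rw [abs_mul, abs_pow, mul_assoc]
    exact mul_le_mul (pow_le_pow_left₀ hδ0 hδ 2) e2 (by positivity) (by positivity)
  have t := abs_add_le (evalR r0 x + δ * evalR r1 x) (δ ^ 2 * evalR r2 x)
  have t' := abs_add_le (evalR r0 x) (δ * evalR r1 x)
  rw [absB3]; push_cast; nlinarith

/-- **Product-free discriminant test on triples**: `X, Y > 0` and `|Z|² < 4 X Y` from the three enclosures; each of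
`X, Y, Z` has its own box half-width (`Δσ`, `Δε`, their mean). [folklore] -/
def posCoreDE3 (S : ℕ) (TX TY TZ : ITriple) (lo hi Wx Wy Wz : ℚ) : Bool :=
  decide (0 < lowB3 S TX lo hi Wx) && decide (0 < lowB3 S TY lo hi Wy) &&
    decide (absB3 S TZ lo hi Wz ^ 2 < 4 * (lowB3 S TX lo hi Wx * lowB3 S TY lo hi Wy))

/-- Bisection to depth `d`. [folklore] -/
def posOnDE3 (S : ℕ) (TX TY TZ : ITriple) (Wx Wy Wz : ℚ) : ℕ → ℚ → ℚ → Bool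
  | 0, a, b => posCoreDE3 S TX TY TZ a b Wx Wy Wz
  | d + 1, a, b =>
      posCoreDE3 S TX TY TZ a b Wx Wy Wz ||
        (posOnDE3 S TX TY TZ Wx Wy Wz d a ((a + b) / 2) && posOnDE3 S TX TY TZ Wx Wy Wz d ((a + b) / 2) b)

/-- The real value of a triple at `(x, δ)`. [folklore] -/
noncomputable def val3 (r : List ℝ × List ℝ × List ℝ) (x δ : ℝ) : ℝ :=
  evalR r.1 x + δ * evalR r.2.1 x + δ ^ 2 * evalR r.2.2 x

/-- Membership of a real triple in an interval triple. [folklore] -/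
structure PMem3 (S : ℕ) (r : List ℝ × List ℝ × List ℝ) (T : ITriple) : Prop where
  /-- order 0 -/
  fst : PMem S r.1 T.1
  /-- order 1 -/
  snd : PMem S r.2.1 T.2.1
  /-- order 2 -/
  thd : PMem S r.2.2 T.2.2

/-- **Soundness of the product-free discriminant test** (three independent `δ`'s). [folklore] -/
theorem posCoreDE3_sound {S : ℕ} (hS : 0 < S) {TX TY TZ : ITriple} {lo hi Wx Wy Wz : ℚ} (hWx : 0 ≤ Wx)
    (hWy : 0 ≤ Wy) (hWz : 0 ≤ Wz) (h : posCoreDE3 S TX TY TZ lo hi Wx Wy Wz = true)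
    {rx ry rz : List ℝ × List ℝ × List ℝ} (hx : PMem3 S rx TX) (hy : PMem3 S ry TY) (hz : PMem3 S rz TZ)
    {x : ℝ} (hlo : (lo : ℝ) ≤ x) (hhi : x ≤ hi) {δx δy δz : ℝ} (hδx : |δx| ≤ Wx) (hδy : |δy| ≤ Wy)
    (hδz : |δz| ≤ Wz) :
    0 < val3 rx x δx ∧ 0 < val3 ry x δy ∧ val3 rz x δz * val3 rz x δz < 4 * (val3 rx x δx * val3 ry x δy) := by
  simp only [posCoreDE3, Bool.and_eq_true, decide_eq_true_eq] at h
  obtain ⟨⟨hX, hY⟩, hD⟩ := h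
  have eX := lowB3_le hS hWx hx.fst hx.snd hx.thd hlo hhi hδx
  have eY := lowB3_le hS hWy hy.fst hy.snd hy.thd hlo hhi hδy
  have eZ := abs_le_absB3 hS hWz hz.fst hz.snd hz.thd hlo hhi hδz
  have hXR : (0 : ℝ) < ((lowB3 S TX lo hi Wx : ℚ) : ℝ) := by exact_mod_cast hX
  have hYR : (0 : ℝ) < ((lowB3 S TY lo hi Wy : ℚ) : ℝ) := by exact_mod_cast hY
  have hDR : ((absB3 S TZ lo hi Wz : ℚ) : ℝ) ^ 2 <
      4 * (((lowB3 S TX lo hi Wx : ℚ) : ℝ) * ((lowB3 S TY lo hi Wy : ℚ) : ℝ)) := by exact_mod_cast hD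
  have hSr : (0 : ℝ) < S := by exact_mod_cast hS
  simp only [val3] at *
  set vx := evalR rx.1 x + δx * evalR rx.2.1 x + δx ^ 2 * evalR rx.2.2 x
  set vy := evalR ry.1 x + δy * evalR ry.2.1 x + δy ^ 2 * evalR ry.2.2 x
  set vz := evalR rz.1 x + δz * evalR rz.2.1 x + δz ^ 2 * evalR rz.2.2 x
  have px : 0 < vx := by nlinarith
  have py : 0 < vy := by nlinarith
  refine ⟨px, py, ?_⟩
  have hz0 : 0 ≤ |vz| * S := by positivity
  have h1 : (|vz| * S) ^ 2 ≤ ((absB3 S TZ lo hi Wz : ℚ) : ℝ) ^ 2 := pow_le_pow_left₀ hz0 eZ 2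
  have h2 : ((lowB3 S TX lo hi Wx : ℚ) : ℝ) * ((lowB3 S TY lo hi Wy : ℚ) : ℝ) ≤ (vx * S) * (vy * S) :=
    mul_le_mul eX eY hYR.le (by positivity)
  have h3 : (vz * vz) * (S * S) < 4 * (vx * vy) * (S * S) := by
    have : (|vz| * S) ^ 2 = vz * vz * (S * S) := by rw [mul_pow, sq_abs]; ring
    nlinarith
  exact lt_of_mul_lt_mul_right h3 (by positivity)

/-- **Soundness of the bisected discriminant test.** [folklore] -/
theorem posOnDE3_sound {S : ℕ} (hS : 0 < S) {TX TY TZ : ITriple} {Wx Wy Wz : ℚ} (hWx : 0 ≤ Wx) (hWy : 0 ≤ Wy)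
    (hWz : 0 ≤ Wz) {rx ry rz : List ℝ × List ℝ × List ℝ} (hx : PMem3 S rx TX) (hy : PMem3 S ry TY)
    (hz : PMem3 S rz TZ) :
    ∀ {d : ℕ} {lo hi : ℚ}, posOnDE3 S TX TY TZ Wx Wy Wz d lo hi = true → ∀ {x : ℝ}, (lo : ℝ) ≤ x → x ≤ hi →
      ∀ {δx δy δz : ℝ}, |δx| ≤ Wx → |δy| ≤ Wy → |δz| ≤ Wz →
        0 < val3 rx x δx ∧ 0 < val3 ry x δy ∧ val3 rz x δz * val3 rz x δz < 4 * (val3 rx x δx * val3 ry x δy)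
  | 0, _, _, h, _, hlo, hhi, _, _, _, hδx, hδy, hδz => posCoreDE3_sound hS hWx hWy hWz h hx hy hz hlo hhi hδx hδy hδz
  | d + 1, a, b, h, x, hlo, hhi, δx, δy, δz, hδx, hδy, hδz => by
      simp only [posOnDE3, Bool.or_eq_true, Bool.and_eq_true] at h
      rcases h with h | ⟨ha, hb⟩
      · exact posCoreDE3_sound hS hWx hWy hWz h hx hy hz hlo hhi hδx hδy hδz
      · have hmR : (((a + b) / 2 : ℚ) : ℝ) = ((a : ℝ) + b) / 2 := by push_cast; ring
        rcases le_or_gt x (((a : ℝ) + b) / 2) with hx' | hx'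
        · exact posOnDE3_sound hS hWx hWy hWz hx hy hz ha hlo (by rw [hmR]; exact hx') hδx hδy hδz
        · exact posOnDE3_sound hS hWx hWy hWz hx hy hz hb (by rw [hmR]; exact hx'.le) hhi hδx hδy hδz

/-! ### (5) One row of the even region over the box: positivity of `X̂` (or `Ŷ`) for `E ∈ [max(E₀, j), E₁]` -/

/-- Row test: `posOn3` on `[max(E₀, j) − cc, E₁ − cc]` for the triple of row `j`, skipped when empty. [folklore] -/
def rowPos3 (S dP : ℕ) (R0 R1 R2 : IPoly) (E0 E1 cc W : ℚ) (j : ℕ) : Bool :=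
  decide (E1 < max E0 (j : ℚ)) || posOn3 S R0 R1 R2 W dP (max E0 (j : ℚ) - cc) (E1 - cc)

/-- **A q-sum is positive on `[max(E₀,j), E₁]` for every `s` in the box** when the row test passes on the δ-tables'
rows. [folklore] -/
theorem qSum_pos_of_rowPos3 {S : ℕ} (hS : 0 < S) (cQ : ℕ × ℕ → ℚ) (σQ : ℚ) (s₀ : ℚ) {W : ℚ} (hW : 0 ≤ W) (ccQ : ℚ)
    {l : List (ℕ × ℕ)} (hl : l.Nodup) {N : ℕ} (hN : deltaSizeOK S cQ σQ s₀ W ccQ l N = true) {dP : ℕ} {E0 E1 : ℚ}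
    {j : ℕ}
    (h : rowPos3 S dP (qRowOfTableI (deltaT0 S cQ σQ s₀ ccQ l) N j) (qRowOfTableI (deltaT1 S cQ σQ s₀ ccQ l) N j)
      (qRowOfTableI (deltaT2 S cQ σQ s₀ W ccQ l) N j) E0 E1 ccQ W j = true)
    {s : ℝ} (hs : |s - s₀| ≤ W) {E : ℝ} (hE0 : (E0 : ℝ) ≤ E) (hjE : (j : ℝ) ≤ E) (hE1 : E ≤ E1) :
    0 < qSum (fun ab => (cQ ab : ℝ)) l.toFinset s (σQ : ℝ) E j := by
  set δ := s - (s₀ : ℝ) with hδdef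
  have hsδ : s = (s₀ : ℝ) + δ := by rw [hδdef]; ring
  rw [hsδ, qSum_eq_delta_rows hS cQ σQ s₀ hW ccQ hl hN hs E j]
  obtain ⟨p0, p1, p2⟩ := pmem_delta_rows hS cQ σQ s₀ hW ccQ l N j hs
  simp only [rowPos3, Bool.or_eq_true, decide_eq_true_eq] at h
  have hlo : ((max E0 (j : ℚ) : ℚ) : ℝ) ≤ E := by push_cast; exact max_le hE0 hjE
  rcases h with hvac | hpos
  · exfalso
    have : ((E1 : ℚ) : ℝ) < ((max E0 (j : ℚ) : ℚ) : ℝ) := by exact_mod_cast hvac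
    linarith
  · exact posOn3_sound hS hW p0 p1 p2 hpos (x := E - ccQ) (by push_cast at hlo ⊢; linarith)
      (by push_cast; linarith) hs

end Summit.CriticalPhenomena.Ising3D
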